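import Literature.MathematicalPhysics.QuantumFieldTheory.Balaban1983to89.B11Eq117LetterDefectsTowerPiTwoBackgrounds
import Literature.MathematicalPhysics.QuantumFieldTheory.Balaban1983to89.B11Eq120SolutionContinuity
import Literature.MathematicalPhysics.QuantumFieldTheory.Balaban1983to89.B11Eq44CLetterTower

/-!
# `Balaban1983to89.B11Eq174ChartContinuityTowerPiTwoBackgrounds` — T. Bałaban, *The variational problem and background fields in renormalization group method for
# lattice gauge theories*, Commun. Math. Phys. **102** (1985) 277–309 [Balaban1985Variational] (174) p. 308, (117)–(120) pp. 296–297, (47) p. 285, with T. Bałaban,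
# *Propagators …*, CMP **99** (1985) [Balaban1985BackgroundPropagators] (3.122) p. 420, Thm 3.4 p. 400: **THE `k`-LEVEL CHART (174) AT PRINT's OPERATOR (3.122) IS
# LIPSCHITZ BETWEEN TWO SMALL BACKGROUNDS — the configuration `arg` of the contraction (120) and the full chart `(174)∘(47)` differ between `U` and `V` by
# `O(δ)·(data)` in the (115) norms** — the π twin ((T4)-7, the LAST storey) of this lineage's gen-78 `B11Eq174ChartContinuityTowerTwoBackgrounds`, VERBATIM its
# text with the (117) defects swapped for `B11Eq117LetterDefectsTowerPiTwoBackgrounds`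

statement-level skeleton of published theorems with citation tags; proofs where landed; nothing here is a claim about the Yang–Mills mass gap

PDF held: `paper:balaban1985-cmp102-variational-background` pp. 285, 295–297, 308; `paper:balaban1985-cmp99-background-propagators` pp. 400, 420 — through the verbatim
quotations of `B11Eq174ChartContinuityAtFlat` (NE9 owner gen 82), whose two theorems the gen-78 file runs at `k = n+1` levels between two backgrounds; print proves
analyticity in `𝔄`∕`B` at a fixed background and analyticity of the LETTERS in the background; the Lipschitz continuity of the chart between two backgrounds is the
cell's composition of the two, here at PRINT's letters `𝔊̃_k`, `H̃_k` (the `G₀`-slot original: at the chain's `𝔊_k`, `H_k`).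

CITATION HEADER (lean-in-tree rule 2026-08-18).  Audit cell `pub-balaban`, sub-cell `t4`, NE9 crux team (2): LEAF PROVER 04 (`b2b-balaban-t4-ne9-formalise-leaf-04`
gen 79), INTENT-10 = (T4)-7 (the row OWNER t4-ne9-p1's GO `CLAIMS.log` l.53352 W-9 (α) «(T3)∕(T4) the π twins … for the successor»).  With this file the
two-background («(b3)») ladder of NE9's chart consumer stands at PRINT's operator (3.122) as it stands at the chain's `G₀`-slot: form defect → Green's function →
`H̃`∕`𝔊̃` rows → energy-ball junction → (117) → (174).

WHAT IS PROVED (sorry-free; 0 `def`; [folklore] composition BY NAME; nothing of [B9] ∕ [B11] asserted as printed).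
* **`exists_chart_arg_lipschitz_tower_pi_two_backgrounds`**, **`exists_chartHB_lipschitz_tower_pi_two_backgrounds`** — the gen-78 statements with the positivity
  witnesses `hposU`, `hposV` now of `laplaceAkPi` at `U`, `V` (plus ANY `hpos′_U`, `hpos′_V` defining `G′_k`; the real letter of `Q_k*aQ_k` is `a₀`, that of
  `Δ′_{a′}` is `aP` — the chart's regime binders keep their printed names `a`, `a′`): `∃ α₀ δ₀ K > 0` FIRST; then, for two contraction regimes at `U` and `V` and
  data `B` in both balls, the configurations `arg_U(B) − arg_V(B)` resp. the charts `chartHB_U(B) − chartHB_V(B)` are bounded in the (115) norm by the gen-78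
  displayed products times `δ`.  MECHANISM: `exists_letter_defects_tower_pi_two_backgrounds_closed` ((K_ι), (δ_G), (δ_A) at PRINT's letters) fed to the OWNER's
  `B11Eq120SolutionContinuity.norm_map_arg_sub_arg_le` ∕ `norm_map_chartHB_sectC_sub_le` exactly as in the gen-78 file; `Cck` for the Sect. C letter.
MODEL ∕ DECLARED READINGS ∕ HONEST SCOPE.  Those of the gen-78 file and of (T4)-5∕-6: every window ∕ profile ∕ closeness letter, E162's data, unitarity + trace
letters, `ρ_w`, the witnesses and the two regimes are HYPOTHESES; the (117) products are finite-lattice numbers (level AND volume; NOT print's `B₀`); FIRST order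
between two small backgrounds (no analyticity in `U`); no decay, no kernel bound, NOT the (N)-reading.  NOT summit progress (cell pub-balaban: NE9 NOT PRINTED ∕ NOT
PROVED; «NE9 ⇐ the named binders»; row WALLED ON A MODEL (O-NE9-1; #5 UNRULED); spine PROVED 0∕9; rung (B)+1 finite T⁴ — NOT infinite volume, NOT mass gap, NOT
BetaPertH, NOT Clay).  HONEST DEPENDENCY (cell line): continuum YM on T⁴ ⇐ BetaPertH ∧ nine spine estimates (0/9 proved); BetaPertH ⇐ (D1) ∧ (D4) ∧ CAP+tail;
G-an2-4 gates asym, D1 and NE2/3/4.  NEW file; nothing modified.  Net new unproved facts: 0.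
-/

noncomputable section

namespace Literature.MathematicalPhysics.QuantumFieldTheory.Balaban1983to89.B11Eq174ChartContinuityTowerPiTwoBackgrounds

open scoped InnerProductSpace ComplexConjugate
open B11Eq115Space B11Eq111FrakG B11Eq103H1Complex
open B11Eq174Chart (Regime solA chartHB)
open B9SectCLatticeCarrier (Bond)
open B4Sect5Torus (TSite)
open B7Prop1Explicit (U1 Wcx boxVec)
open B9Eq310HessianOperator (adTransportW)
open B9Eq310DeltaPrime (plaqHolU)
open B9Eq315QTorus (perCfg cornerSite)
open B9Eq315QTower (towerP UlevOf)
open B9Eq326OperatorTower (QkW)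
open B9Eq324DeltaPrimeATower (laplacePrimeAk)
open B9Eq3119DeltaPiTower (laplaceAkPi)
open B11Eq117LetterDefectsTowerPiTwoBackgrounds (exists_letter_defects_tower_pi_two_backgrounds_closed)
open B11Eq120SolutionContinuity (norm_map_arg_sub_arg_le norm_map_chartHB_sectC_sub_le)
open B11Eq44CLetterTower (Cck)

variable {d : ℕ} (hd : 1 ≤ d) (L : ℕ) [NeZero L] (hL : 1 ≤ L)
  {𝔸 : Type*} [NormedRing 𝔸] [NormedAlgebra ℂ 𝔸] [CompleteSpace 𝔸] [NormOneClass 𝔸] [StarRing 𝔸] [NormedStarGroup 𝔸] [StarModule ℂ 𝔸]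
  [FiniteDimensional ℂ 𝔸]
  {W : Type*} [NormedAddCommGroup W] [InnerProductSpace ℂ W] [FiniteDimensional ℂ W] (φ : W ≃ₗ[ℂ] 𝔸)
  {Mφ Mφ' : ℝ} (hMφ : 0 ≤ Mφ) (hMφ' : 0 ≤ Mφ') (hφ : ∀ w, ‖φ w‖ ≤ Mφ * ‖w‖) (hφ' : ∀ X, ‖φ.symm X‖ ≤ Mφ' * ‖X‖)
  {a₀ : ℝ} (ha₀ : 0 < a₀) {aP : ℝ} (haP : 0 < aP) {r : ℝ} (hr0 : 0 ≤ r) (hr1 : r < 1)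
  (τ : 𝔸 →ₗ[ℂ] ℂ) {Cτ : ℝ} (hτ : ∀ X, ‖τ X‖ ≤ Cτ * ‖X‖) (hCτ : 0 ≤ Cτ) {ρw : ℝ} (hρw : 0 ≤ ρw)
  (hτ₁ : ∀ X : 𝔸, τ (star X) = conj (τ X)) (hτ₂ : ∀ X Y : 𝔸, τ (X * Y) = τ (Y * X))
  (hφτ : ∀ X Y : 𝔸, ⟪φ.symm X, φ.symm Y⟫_ℂ = τ (star X * Y))

include hd hMφ hMφ' hφ hφ' ha₀ haP hr0 hr1 hτ hCτ hρw hτ₁ hτ₂ hφτ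

set_option maxHeartbeats 800000 in
set_option maxRecDepth 8192 in
/-- **THE CONFIGURATION OF THE CHART (174) AT PRINT's `k`-TH-STEP LETTERS ((3.122)) IS LIPSCHITZ IN THE BACKGROUND BETWEEN TWO SMALL BACKGROUNDS (diagonal,
`Λ := 0`, `J := 0` face)** — `∃ α₀ δ₀ K > 0` (`K` level-free) before every binder; then under INTENT-2's binders, for all (L3) slots, regimes, block
fields and moduli as displayed: `‖ι(𝒜_U(H_k(U)B) + H_k(U)B) − (𝒜_V(H_k(V)B) + H_k(V)B)‖_(115),∇_V ≤ (K·V_G·δ·(j + C₄(ε₄ + a)²) + B₀′δ_W + K·V_H·δ·‖B‖)∕(1 − κ₂)`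
— the defects `K_ι`, `δ_G = K·V_G·δ`, `δ_A = K·V_H·δ·‖B‖` PRODUCED by INTENT-2, composed by the owner's `norm_map_arg_sub_arg_le`; this lineage's one-step
`exists_chart_arg_lipschitz_twoBackgrounds` one storey up. [folklore]
[cite: Balaban1985Variational, Prop. 6 (116)–(121) p.295, (117) p.295, (174)–(175) p.305, Prop. 9 p.309; Balaban1985BackgroundPropagators, Thm 3.4 p.400, (3.86) p.407] -/
theorem exists_chart_arg_lipschitz_tower_pi_two_backgrounds [Fact (0 < (L : ℝ))] :
    ∃ α₀ δ₀ K : ℝ, 0 < α₀ ∧ 0 < δ₀ ∧ 0 < K ∧ ∀ (n : ℕ) (η : ℝ) [Fact (0 < η)], η * (L : ℝ) ^ (n + 1) = 1 → 3 ≤ L ^ (n + 1) →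
      ∀ (c₀ c₁ : ℝ) [Fact (0 < c₀)] [Fact (0 < c₁)], c₀ * ((L : ℝ) ^ (n + 1)) ^ d = c₁ → |η| ^ d / c₀ ≤ ρw →
      ∀ (m : Fin d → ℕ) [∀ i, NeZero (m i)] (lev₀ : Bond d (towerP L m (n + 1)) → ℕ) (levB : Bond d m → ℕ)
        (lev₁ : Bond d (towerP L m (n + 1)) × Fin d → ℕ)
        (U V : Bond d (towerP L m (n + 1)) → 𝔸ˣ) (αU : ℕ → ℝ) (hα1 : ∀ j, αU j ≤ 1 / 64)
        (hU1 : ∀ (j : ℕ) (x : B7Prop1Explicit.Site d) (κ : Fin d), perCfg (towerP L m (j + 1)) (UlevOf L m (n + 1) U j) x κ ∈ U1 𝔸)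
        (hreg : ∀ (j : ℕ) (y : TSite d (towerP L m j)) (κ : Fin d) (r : Fin d → Fin L),
          ‖((Wcx L (perCfg (towerP L m (j + 1)) (UlevOf L m (n + 1) U j)) (cornerSite L y) κ (boxVec L r) : 𝔸ˣ) : 𝔸) - 1‖ ≤ αU j)
        (αV : ℕ → ℝ) (hα1' : ∀ j, αV j ≤ 1 / 64)
        (hV1 : ∀ (j : ℕ) (x : B7Prop1Explicit.Site d) (κ : Fin d), perCfg (towerP L m (j + 1)) (UlevOf L m (n + 1) V j) x κ ∈ U1 𝔸)
        (hregV : ∀ (j : ℕ) (y : TSite d (towerP L m j)) (κ : Fin d) (r : Fin d → Fin L),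
          ‖((Wcx L (perCfg (towerP L m (j + 1)) (UlevOf L m (n + 1) V j)) (cornerSite L y) κ (boxVec L r) : 𝔸ˣ) : 𝔸) - 1‖ ≤ αV j),
        (∀ j, αV j ≤ 1 / 128) →
      ∀ (εU : ℕ → ℝ), (∀ j, 0 ≤ εU j) → (∀ (j : ℕ) (b : Bond d (towerP L m (j + 1))), ‖(UlevOf L m (n + 1) U j b : 𝔸) - 1‖ ≤ εU j) →
        (∀ (j : ℕ) (b : Bond d (towerP L m (j + 1))), ‖(UlevOf L m (n + 1) V j b : 𝔸) - 1‖ ≤ εU j) →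
      ∀ (δUV : ℕ → ℝ), (∀ j, 0 ≤ δUV j) →
        (∀ (j : ℕ) (b : Bond d (towerP L m (j + 1))), ‖(UlevOf L m (n + 1) U j b : 𝔸) - (UlevOf L m (n + 1) V j b : 𝔸)‖ ≤ δUV j) →
      ∀ {α δ : ℝ}, 0 ≤ α → α ≤ α₀ → 0 ≤ δ → δ ≤ δ₀ →
        (∀ b, star (U b : 𝔸) = (((U b)⁻¹ : 𝔸ˣ) : 𝔸)) → (∀ b, star (V b : 𝔸) = (((V b)⁻¹ : 𝔸ˣ) : 𝔸)) →
        (∀ b, U b ∈ U1 𝔸) → (∀ b, V b ∈ U1 𝔸) → (∀ b, ‖(U b : 𝔸) - 1‖ ≤ α * η) → (∀ b, ‖(V b : 𝔸) - 1‖ ≤ α * η) →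
        (∀ p : B9SectCLatticeCarrier.Plaq d (towerP L m (n + 1)), ‖(plaqHolU U p : 𝔸) - 1‖ ≤ α * η ^ 2) →
        (∀ p : B9SectCLatticeCarrier.Plaq d (towerP L m (n + 1)), ‖(plaqHolU V p : 𝔸) - 1‖ ≤ α * η ^ 2) →
        (∀ b, ‖(U b : 𝔸) - (V b : 𝔸)‖ ≤ δ * η) →
        (∀ p : B9SectCLatticeCarrier.Plaq d (towerP L m (n + 1)), ‖(plaqHolU U p : 𝔸) - (plaqHolU V p : 𝔸)‖ ≤ δ * η ^ 2) →
        (∀ j < n + 1, εU j ≤ α * r ^ j) → (∀ j, δUV j ≤ δ * r ^ j) →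
        ∀ (hposU' : ∀ x : SiteL2K ℂ d (towerP L m (n + 1)) c₀ W, x ≠ 0 → 0 < RCLike.re ⟪x, laplacePrimeAk L m n φ η U aP (c₁ := c₁) x⟫_ℂ)
          (hposV' : ∀ x : SiteL2K ℂ d (towerP L m (n + 1)) c₀ W, x ≠ 0 → 0 < RCLike.re ⟪x, laplacePrimeAk L m n φ η V aP (c₁ := c₁) x⟫_ℂ)
          (hposU : ∀ x : BondL2K ℂ d (towerP L m (n + 1)) c₀ W, x ≠ 0 →
            0 < RCLike.re ⟪x, laplaceAkPi L m n φ τ η U aP hposU' hL αU hα1 hU1 hreg (c₁ := c₁) a₀ x⟫_ℂ)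
          (hposV : ∀ x : BondL2K ℂ d (towerP L m (n + 1)) c₀ W, x ≠ 0 →
            0 < RCLike.re ⟪x, laplaceAkPi L m n φ τ η V aP hposV' hL αV hα1' hV1 hregV (c₁ := c₁) a₀ x⟫_ℂ)
          (hQU : Function.Surjective (QkW L m n φ U hL αU hα1 hU1 hreg (c₀ := c₀) (c₁ := c₁)))
          (hQV : Function.Surjective (QkW L m n φ V hL αV hα1' hV1 hregV (c₀ := c₀) (c₁ := c₁)))
          {W₁ : Space115 (L : ℝ) η lev₀ lev₁ (nabla115 η U) → NegSize (L : ℝ) η lev₀ 3 𝔸}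
          {W₂ : Space115 (L : ℝ) η lev₀ lev₁ (nabla115 η V) → NegSize (L : ℝ) η lev₀ 3 𝔸}
          {B₀ θ C₄ a₃ j a ε₄ B₀' θ' C₄' a₃' j' a' ε₄' δW ρ s : ℝ}
          (_R₁ : Regime (frakGLatticeCLM (L := (L : ℝ)) (η := η) (lev₀ := lev₀) φ hposU hQU lev₁ (nabla115 η U)) 0 W₁ B₀ θ C₄ a₃ j a ε₄)
          (_R₂ : Regime (frakGLatticeCLM (L := (L : ℝ)) (η := η) (lev₀ := lev₀) φ hposV hQV lev₁ (nabla115 η V)) 0 W₂ B₀' θ' C₄' a₃' j' a' ε₄')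
          (_hj : 0 ≤ j) (_hj' : 0 ≤ j') (B : NegSize (L : ℝ) η levB 0 𝔸)
          (_hB : ‖H1LatticeCLM (L := (L : ℝ)) (η := η) (lev₀ := lev₀) (levB := levB) φ hposU hQU lev₁ (nabla115 η U) B‖ < a)
          (_hB' : ‖H1LatticeCLM (L := (L : ℝ)) (η := η) (lev₀ := lev₀) (levB := levB) φ hposV hQV lev₁ (nabla115 η V) B‖ < a')
          (_hδW : ∀ P : Space115 (L : ℝ) η lev₀ lev₁ (nabla115 η U), ‖P‖ < ε₄ + a →
            ‖W₁ P - W₂ (LinearMap.toContinuousLinearMap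
              ((jetLinearEquiv (L : ℝ) η lev₀ lev₁ (nabla115 η V)).symm.toLinearMap ∘ₗ
                (jetLinearEquiv (L : ℝ) η lev₀ lev₁ (nabla115 η U)).toLinearMap) P)‖ ≤ δW)
          (_hρ₁ : (1 + (NegSup.wSup (levWeight (L : ℝ) η lev₁ 2) : ℝ) * (2 * ‖((η : ℂ))⁻¹‖ * (δ * η)) * NegSup.wInvSup (levWeight (L : ℝ) η lev₀ 1)) *
            (ε₄ + a) ≤ ρ)
          (_hρ₂ : ε₄' + a' ≤ ρ) (_hs : 0 < s) (_hdom : 2 * (ρ + s) ≤ a₃') (_hκ : θ' + 4 * B₀' * C₄' * (ρ + s) < 1),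
        ‖LinearMap.toContinuousLinearMap
              ((jetLinearEquiv (L : ℝ) η lev₀ lev₁ (nabla115 η V)).symm.toLinearMap ∘ₗ
                (jetLinearEquiv (L : ℝ) η lev₀ lev₁ (nabla115 η U)).toLinearMap)
            (solA (frakGLatticeCLM (L := (L : ℝ)) (η := η) (lev₀ := lev₀) φ hposU hQU lev₁ (nabla115 η U)) 0 W₁ 0 ε₄
                (H1LatticeCLM (L := (L : ℝ)) (η := η) (lev₀ := lev₀) (levB := levB) φ hposU hQU lev₁ (nabla115 η U) B) +
              H1LatticeCLM (L := (L : ℝ)) (η := η) (lev₀ := lev₀) (levB := levB) φ hposU hQU lev₁ (nabla115 η U) B) -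
          (solA (frakGLatticeCLM (L := (L : ℝ)) (η := η) (lev₀ := lev₀) φ hposV hQV lev₁ (nabla115 η V)) 0 W₂ 0 ε₄'
              (H1LatticeCLM (L := (L : ℝ)) (η := η) (lev₀ := lev₀) (levB := levB) φ hposV hQV lev₁ (nabla115 η V) B) +
            H1LatticeCLM (L := (L : ℝ)) (η := η) (lev₀ := lev₀) (levB := levB) φ hposV hQV lev₁ (nabla115 η V) B)‖ ≤
          (K * (max (NegSup.wSup (levWeight (L : ℝ) η lev₀ 1) : ℝ) (NegSup.wSup (levWeight (L : ℝ) η lev₁ 2) * (2 * ‖((η : ℂ))⁻¹‖)) *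
                (Mφ * Real.sqrt (c₀ * Fintype.card (Bond d (towerP L m (n + 1)))) * Mφ' / Real.sqrt c₀) *
                NegSup.wInvSup (levWeight (L : ℝ) η lev₀ 3)) * δ * (j + C₄ * (ε₄ + a) ^ 2) + B₀' * δW +
            K * (max (NegSup.wSup (levWeight (L : ℝ) η lev₀ 1) : ℝ) (NegSup.wSup (levWeight (L : ℝ) η lev₁ 2) * (2 * ‖((η : ℂ))⁻¹‖)) *
                (Mφ * Real.sqrt (c₁ * Fintype.card (Bond d m)) * Mφ' / Real.sqrt c₀) *
                NegSup.wInvSup (levWeight (L : ℝ) η levB 0)) * δ * ‖B‖) / (1 - (θ' + 4 * B₀' * C₄' * (ρ + s))) := by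
  obtain ⟨α₀, δ₀, K, hα₀, hδ₀, hK, H⟩ :=
    exists_letter_defects_tower_pi_two_backgrounds_closed hd L hL φ hMφ hMφ' hφ hφ' ha₀ haP hr0 hr1 τ hτ hCτ hρw hτ₁ hτ₂ hφτ
  refine ⟨α₀, δ₀, K, hα₀, hδ₀, hK, ?_⟩
  intro n η _ hηL hL3 c₀ c₁ _ _ hw hρ m _ lev₀ levB lev₁ U V αU hα1 hU1 hreg αV hα1' hV1 hregV hα128 εU hεU hUε hVε δUV hδUV hLUV α δ hα0 hαle hδ0 hδle
    hUst hVst hUb hVb hUη hVη hplU hplV hUV hpp hεg hδg hposU' hposV' hposU hposV hQU hQV W₁ W₂ B₀ θ C₄ a₃ j a ε₄ B₀' θ' C₄' a₃' j' a' ε₄' δW ρ s R₁ R₂ hj hj' B hB hB'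
    hδW hρ₁ hρ₂ hs hdom hκ
  obtain ⟨hι, HG, HA⟩ := H n η hηL hL3 c₀ c₁ hw hρ m lev₀ levB lev₁ U V αU hα1 hU1 hreg αV hα1' hV1 hregV hα128 εU hεU hUε hVε δUV hδUV hLUV hα0 hαle
    hδ0 hδle hUst hVst hUb hVb hUη hVη hplU hplV hUV hpp hεg hδg hposU' hposV' hposU hposV hQU hQV
  have hJ : ‖(0 : NegSize (L : ℝ) η lev₀ 3 𝔸)‖ ≤ j := by rw [norm_zero]; exact hj
  have hJ' : ‖(0 : NegSize (L : ℝ) η lev₀ 3 𝔸)‖ ≤ j' := by rw [norm_zero]; exact hj'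
  have hδη : 0 ≤ δ * η := mul_nonneg hδ0 (le_of_lt (Fact.out : 0 < η))
  have hδΛ : ∀ y : Space115 (L : ℝ) η lev₀ lev₁ (nabla115 η U),
      ‖LinearMap.toContinuousLinearMap
          ((jetLinearEquiv (L : ℝ) η lev₀ lev₁ (nabla115 η V)).symm.toLinearMap ∘ₗ
            (jetLinearEquiv (L : ℝ) η lev₀ lev₁ (nabla115 η U)).toLinearMap) ((0 : _ →L[ℂ] _) y) -
        (0 : _ →L[ℂ] _) (LinearMap.toContinuousLinearMap
          ((jetLinearEquiv (L : ℝ) η lev₀ lev₁ (nabla115 η V)).symm.toLinearMap ∘ₗ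
            (jetLinearEquiv (L : ℝ) η lev₀ lev₁ (nabla115 η U)).toLinearMap) y)‖ ≤ 0 * ‖y‖ := fun y => by simp
  have hKG : 0 ≤ K * (max (NegSup.wSup (levWeight (L : ℝ) η lev₀ 1) : ℝ) (NegSup.wSup (levWeight (L : ℝ) η lev₁ 2) * (2 * ‖((η : ℂ))⁻¹‖)) *
      (Mφ * Real.sqrt (c₀ * Fintype.card (Bond d (towerP L m (n + 1)))) * Mφ' / Real.sqrt c₀) * NegSup.wInvSup (levWeight (L : ℝ) η lev₀ 3)) * δ := by
    have : 0 ≤ (max (NegSup.wSup (levWeight (L : ℝ) η lev₀ 1) : ℝ) (NegSup.wSup (levWeight (L : ℝ) η lev₁ 2) * (2 * ‖((η : ℂ))⁻¹‖))) :=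
      le_max_of_le_left (NegSup.wSup (levWeight (L : ℝ) η lev₀ 1)).coe_nonneg
    positivity
  have hG' : ∀ f : NegSize (L : ℝ) η lev₀ 3 𝔸,
      ‖LinearMap.toContinuousLinearMap
          ((jetLinearEquiv (L : ℝ) η lev₀ lev₁ (nabla115 η V)).symm.toLinearMap ∘ₗ
            (jetLinearEquiv (L : ℝ) η lev₀ lev₁ (nabla115 η U)).toLinearMap)
          (frakGLatticeCLM (L := (L : ℝ)) (η := η) (lev₀ := lev₀) φ hposU hQU lev₁ (nabla115 η U) f) -
        frakGLatticeCLM (L := (L : ℝ)) (η := η) (lev₀ := lev₀) φ hposV hQV lev₁ (nabla115 η V) f‖ ≤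
      (K * (max (NegSup.wSup (levWeight (L : ℝ) η lev₀ 1) : ℝ) (NegSup.wSup (levWeight (L : ℝ) η lev₁ 2) * (2 * ‖((η : ℂ))⁻¹‖)) *
        (Mφ * Real.sqrt (c₀ * Fintype.card (Bond d (towerP L m (n + 1)))) * Mφ' / Real.sqrt c₀) * NegSup.wInvSup (levWeight (L : ℝ) η lev₀ 3)) * δ) * ‖f‖ :=
    fun f => (HG f).trans_eq (by ring)
  have h := norm_map_arg_sub_arg_le (J := (0 : NegSize (L : ℝ) η lev₀ 3 𝔸)) R₁ R₂ hJ hJ' hB hB' (by positivity) hι hKG le_rfl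
    hG' hδΛ hδW (HA B) hρ₁ hρ₂ hs hdom hκ
  refine h.trans (le_of_eq ?_)
  congr 1
  ring

set_option maxHeartbeats 800000 in
set_option maxRecDepth 8192 in
/-- **THE FULL CHART (174)∘(47) OF `cur U` AT PRINT's `k`-TH-STEP LETTERS ((3.122)) IS LIPSCHITZ IN THE BACKGROUND BETWEEN TWO SMALL BACKGROUNDS (diagonal)** — the
species' `chartHB 𝔊_k(X) 0 W 0 (A′ ↦ A′ + solA H_k(X) 0 C_k(X) 0 ε_C A′) ε₄ H_k(X)` at `X = U` read into the (115) norm at `∇_V` against `X = V`: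
`‖ι(chartHB_U B) − chartHB_V B‖ ≤ (K·V_G·δ·(j + C₄(ε₄+a)²) + B₀′δ_W + K·V_H·δ·‖B‖)∕((1 − κ₂)(1 − κ_C)) + (K·V_H·δ·C₂(ε_C + a_C)² + b′δ_C)∕(1 − κ_C)`, the
letter defects PRODUCED by INTENT-2, the (L3) slot's modulus `δ_W`, the `C_k`-letter's modulus `δ_C` (`B11Eq44CLetterTower.Cck` at `U` against `V`) and
the four regimes' scalar letters DISPLAYED; composition by the owner's `norm_map_chartHB_sectC_sub_le`. [folklore]
[cite: Balaban1985Variational, (174)–(175) p.305, (44) p.285, (47)–(50) p.285, Prop. 6 (116)–(121) p.295, (117) p.295, Prop. 9 p.309; Balaban1985BackgroundPropagators, Thm 3.4 p.400] -/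
theorem exists_chartHB_lipschitz_tower_pi_two_backgrounds [Fact (0 < (L : ℝ))] :
    ∃ α₀ δ₀ K : ℝ, 0 < α₀ ∧ 0 < δ₀ ∧ 0 < K ∧ ∀ (n : ℕ) (η : ℝ) [Fact (0 < η)], η * (L : ℝ) ^ (n + 1) = 1 → 3 ≤ L ^ (n + 1) →
      ∀ (c₀ c₁ : ℝ) [Fact (0 < c₀)] [Fact (0 < c₁)], c₀ * ((L : ℝ) ^ (n + 1)) ^ d = c₁ → |η| ^ d / c₀ ≤ ρw →
      ∀ (m : Fin d → ℕ) [∀ i, NeZero (m i)] (lev₀ : Bond d (towerP L m (n + 1)) → ℕ) (levB : Bond d m → ℕ)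
        (lev₁ : Bond d (towerP L m (n + 1)) × Fin d → ℕ)
        (U V : Bond d (towerP L m (n + 1)) → 𝔸ˣ) (αU : ℕ → ℝ) (hα1 : ∀ j, αU j ≤ 1 / 64)
        (hU1 : ∀ (j : ℕ) (x : B7Prop1Explicit.Site d) (κ : Fin d), perCfg (towerP L m (j + 1)) (UlevOf L m (n + 1) U j) x κ ∈ U1 𝔸)
        (hreg : ∀ (j : ℕ) (y : TSite d (towerP L m j)) (κ : Fin d) (r : Fin d → Fin L),
          ‖((Wcx L (perCfg (towerP L m (j + 1)) (UlevOf L m (n + 1) U j)) (cornerSite L y) κ (boxVec L r) : 𝔸ˣ) : 𝔸) - 1‖ ≤ αU j)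
        (αV : ℕ → ℝ) (hα1' : ∀ j, αV j ≤ 1 / 64)
        (hV1 : ∀ (j : ℕ) (x : B7Prop1Explicit.Site d) (κ : Fin d), perCfg (towerP L m (j + 1)) (UlevOf L m (n + 1) V j) x κ ∈ U1 𝔸)
        (hregV : ∀ (j : ℕ) (y : TSite d (towerP L m j)) (κ : Fin d) (r : Fin d → Fin L),
          ‖((Wcx L (perCfg (towerP L m (j + 1)) (UlevOf L m (n + 1) V j)) (cornerSite L y) κ (boxVec L r) : 𝔸ˣ) : 𝔸) - 1‖ ≤ αV j),
        (∀ j, αV j ≤ 1 / 128) →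
      ∀ (εU : ℕ → ℝ), (∀ j, 0 ≤ εU j) → (∀ (j : ℕ) (b : Bond d (towerP L m (j + 1))), ‖(UlevOf L m (n + 1) U j b : 𝔸) - 1‖ ≤ εU j) →
        (∀ (j : ℕ) (b : Bond d (towerP L m (j + 1))), ‖(UlevOf L m (n + 1) V j b : 𝔸) - 1‖ ≤ εU j) →
      ∀ (δUV : ℕ → ℝ), (∀ j, 0 ≤ δUV j) →
        (∀ (j : ℕ) (b : Bond d (towerP L m (j + 1))), ‖(UlevOf L m (n + 1) U j b : 𝔸) - (UlevOf L m (n + 1) V j b : 𝔸)‖ ≤ δUV j) →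
      ∀ {α δ : ℝ}, 0 ≤ α → α ≤ α₀ → 0 ≤ δ → δ ≤ δ₀ →
        (∀ b, star (U b : 𝔸) = (((U b)⁻¹ : 𝔸ˣ) : 𝔸)) → (∀ b, star (V b : 𝔸) = (((V b)⁻¹ : 𝔸ˣ) : 𝔸)) →
        (∀ b, U b ∈ U1 𝔸) → (∀ b, V b ∈ U1 𝔸) → (∀ b, ‖(U b : 𝔸) - 1‖ ≤ α * η) → (∀ b, ‖(V b : 𝔸) - 1‖ ≤ α * η) →
        (∀ p : B9SectCLatticeCarrier.Plaq d (towerP L m (n + 1)), ‖(plaqHolU U p : 𝔸) - 1‖ ≤ α * η ^ 2) →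
        (∀ p : B9SectCLatticeCarrier.Plaq d (towerP L m (n + 1)), ‖(plaqHolU V p : 𝔸) - 1‖ ≤ α * η ^ 2) →
        (∀ b, ‖(U b : 𝔸) - (V b : 𝔸)‖ ≤ δ * η) →
        (∀ p : B9SectCLatticeCarrier.Plaq d (towerP L m (n + 1)), ‖(plaqHolU U p : 𝔸) - (plaqHolU V p : 𝔸)‖ ≤ δ * η ^ 2) →
        (∀ j < n + 1, εU j ≤ α * r ^ j) → (∀ j, δUV j ≤ δ * r ^ j) →
        ∀ (hposU' : ∀ x : SiteL2K ℂ d (towerP L m (n + 1)) c₀ W, x ≠ 0 → 0 < RCLike.re ⟪x, laplacePrimeAk L m n φ η U aP (c₁ := c₁) x⟫_ℂ)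
          (hposV' : ∀ x : SiteL2K ℂ d (towerP L m (n + 1)) c₀ W, x ≠ 0 → 0 < RCLike.re ⟪x, laplacePrimeAk L m n φ η V aP (c₁ := c₁) x⟫_ℂ)
          (hposU : ∀ x : BondL2K ℂ d (towerP L m (n + 1)) c₀ W, x ≠ 0 →
            0 < RCLike.re ⟪x, laplaceAkPi L m n φ τ η U aP hposU' hL αU hα1 hU1 hreg (c₁ := c₁) a₀ x⟫_ℂ)
          (hposV : ∀ x : BondL2K ℂ d (towerP L m (n + 1)) c₀ W, x ≠ 0 →
            0 < RCLike.re ⟪x, laplaceAkPi L m n φ τ η V aP hposV' hL αV hα1' hV1 hregV (c₁ := c₁) a₀ x⟫_ℂ)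
          (hQU : Function.Surjective (QkW L m n φ U hL αU hα1 hU1 hreg (c₀ := c₀) (c₁ := c₁)))
          (hQV : Function.Surjective (QkW L m n φ V hL αV hα1' hV1 hregV (c₀ := c₀) (c₁ := c₁)))
          {W₁ : Space115 (L : ℝ) η lev₀ lev₁ (nabla115 η U) → NegSize (L : ℝ) η lev₀ 3 𝔸}
          {W₂ : Space115 (L : ℝ) η lev₀ lev₁ (nabla115 η V) → NegSize (L : ℝ) η lev₀ 3 𝔸}
          {B₀ θ C₄ a₃ j a ε₄ B₀' θ' C₄' a₃' j' a' ε₄' δW ρ s : ℝ}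
          (_R₁ : Regime (frakGLatticeCLM (L := (L : ℝ)) (η := η) (lev₀ := lev₀) φ hposU hQU lev₁ (nabla115 η U)) 0 W₁ B₀ θ C₄ a₃ j a ε₄)
          (_R₂ : Regime (frakGLatticeCLM (L := (L : ℝ)) (η := η) (lev₀ := lev₀) φ hposV hQV lev₁ (nabla115 η V)) 0 W₂ B₀' θ' C₄' a₃' j' a' ε₄')
          (_hj : 0 ≤ j) (_hj' : 0 ≤ j') (B : NegSize (L : ℝ) η levB 0 𝔸)
          (_hB : ‖H1LatticeCLM (L := (L : ℝ)) (η := η) (lev₀ := lev₀) (levB := levB) φ hposU hQU lev₁ (nabla115 η U) B‖ < a)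
          (_hB' : ‖H1LatticeCLM (L := (L : ℝ)) (η := η) (lev₀ := lev₀) (levB := levB) φ hposV hQV lev₁ (nabla115 η V) B‖ < a')
          (_hδW : ∀ P : Space115 (L : ℝ) η lev₀ lev₁ (nabla115 η U), ‖P‖ < ε₄ + a →
            ‖W₁ P - W₂ (LinearMap.toContinuousLinearMap
              ((jetLinearEquiv (L : ℝ) η lev₀ lev₁ (nabla115 η V)).symm.toLinearMap ∘ₗ
                (jetLinearEquiv (L : ℝ) η lev₀ lev₁ (nabla115 η U)).toLinearMap) P)‖ ≤ δW)
          (_hρ₁ : (1 + (NegSup.wSup (levWeight (L : ℝ) η lev₁ 2) : ℝ) * (2 * ‖((η : ℂ))⁻¹‖ * (δ * η)) * NegSup.wInvSup (levWeight (L : ℝ) η lev₀ 1)) *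
            (ε₄ + a) ≤ ρ)
          (_hρ₂ : ε₄' + a' ≤ ρ) (_hs : 0 < s) (_hdom : 2 * (ρ + s) ≤ a₃') (_hκ : θ' + 4 * B₀' * C₄' * (ρ + s) < 1)
          {b C₂c c₄ aC εC b' C₂c' c₄' aC' εC' δC ρC sC : ℝ}
          (_RC₁ : Regime (H1LatticeCLM (L := (L : ℝ)) (η := η) (lev₀ := lev₀) (levB := levB) φ hposU hQU lev₁ (nabla115 η U)) 0
            (Cck L m η (n + 1) U lev₀ lev₁ (nabla115 η U) levB) b 0 C₂c c₄ 0 aC εC)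
          (_RC₂ : Regime (H1LatticeCLM (L := (L : ℝ)) (η := η) (lev₀ := lev₀) (levB := levB) φ hposV hQV lev₁ (nabla115 η V)) 0
            (Cck L m η (n + 1) V lev₀ lev₁ (nabla115 η V) levB) b' 0 C₂c' c₄' 0 aC' εC')
          (_hcap : ε₄ + a ≤ aC) (_hcap' : ε₄' + a' ≤ aC')
          (_hδC : ∀ P : Space115 (L : ℝ) η lev₀ lev₁ (nabla115 η U), ‖P‖ < εC + aC →
            ‖Cck L m η (n + 1) U lev₀ lev₁ (nabla115 η U) levB P - Cck L m η (n + 1) V lev₀ lev₁ (nabla115 η V) levB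
              (LinearMap.toContinuousLinearMap
                ((jetLinearEquiv (L : ℝ) η lev₀ lev₁ (nabla115 η V)).symm.toLinearMap ∘ₗ
                  (jetLinearEquiv (L : ℝ) η lev₀ lev₁ (nabla115 η U)).toLinearMap) P)‖ ≤ δC)
          (_hρC₁ : (1 + (NegSup.wSup (levWeight (L : ℝ) η lev₁ 2) : ℝ) * (2 * ‖((η : ℂ))⁻¹‖ * (δ * η)) * NegSup.wInvSup (levWeight (L : ℝ) η lev₀ 1)) *
            (εC + aC) ≤ ρC)
          (_hρC₂ : εC' + aC' ≤ ρC) (_hsC : 0 < sC) (_hdomC : 2 * (ρC + sC) ≤ c₄') (_hκC : 4 * b' * C₂c' * (ρC + sC) < 1),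
        ‖LinearMap.toContinuousLinearMap
              ((jetLinearEquiv (L : ℝ) η lev₀ lev₁ (nabla115 η V)).symm.toLinearMap ∘ₗ
                (jetLinearEquiv (L : ℝ) η lev₀ lev₁ (nabla115 η U)).toLinearMap)
            (chartHB (frakGLatticeCLM (L := (L : ℝ)) (η := η) (lev₀ := lev₀) φ hposU hQU lev₁ (nabla115 η U)) 0 W₁ 0
              (fun A' => A' + solA (H1LatticeCLM (L := (L : ℝ)) (η := η) (lev₀ := lev₀) (levB := levB) φ hposU hQU lev₁ (nabla115 η U)) 0
                (Cck L m η (n + 1) U lev₀ lev₁ (nabla115 η U) levB) 0 εC A') ε₄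
              (H1LatticeCLM (L := (L : ℝ)) (η := η) (lev₀ := lev₀) (levB := levB) φ hposU hQU lev₁ (nabla115 η U)) B) -
          chartHB (frakGLatticeCLM (L := (L : ℝ)) (η := η) (lev₀ := lev₀) φ hposV hQV lev₁ (nabla115 η V)) 0 W₂ 0
            (fun A' => A' + solA (H1LatticeCLM (L := (L : ℝ)) (η := η) (lev₀ := lev₀) (levB := levB) φ hposV hQV lev₁ (nabla115 η V)) 0
              (Cck L m η (n + 1) V lev₀ lev₁ (nabla115 η V) levB) 0 εC' A') ε₄'
            (H1LatticeCLM (L := (L : ℝ)) (η := η) (lev₀ := lev₀) (levB := levB) φ hposV hQV lev₁ (nabla115 η V)) B‖ ≤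
          1 / (1 - 4 * b' * C₂c' * (ρC + sC)) *
              ((K * (max (NegSup.wSup (levWeight (L : ℝ) η lev₀ 1) : ℝ) (NegSup.wSup (levWeight (L : ℝ) η lev₁ 2) * (2 * ‖((η : ℂ))⁻¹‖)) *
                    (Mφ * Real.sqrt (c₀ * Fintype.card (Bond d (towerP L m (n + 1)))) * Mφ' / Real.sqrt c₀) *
                    NegSup.wInvSup (levWeight (L : ℝ) η lev₀ 3)) * δ * (j + C₄ * (ε₄ + a) ^ 2) + 0 * (ε₄ + a) + B₀' * δW +
                K * (max (NegSup.wSup (levWeight (L : ℝ) η lev₀ 1) : ℝ) (NegSup.wSup (levWeight (L : ℝ) η lev₁ 2) * (2 * ‖((η : ℂ))⁻¹‖)) *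
                    (Mφ * Real.sqrt (c₁ * Fintype.card (Bond d m)) * Mφ' / Real.sqrt c₀) *
                    NegSup.wInvSup (levWeight (L : ℝ) η levB 0)) * δ * ‖B‖) / (1 - (θ' + 4 * B₀' * C₄' * (ρ + s)))) +
            (K * (max (NegSup.wSup (levWeight (L : ℝ) η lev₀ 1) : ℝ) (NegSup.wSup (levWeight (L : ℝ) η lev₁ 2) * (2 * ‖((η : ℂ))⁻¹‖)) *
                  (Mφ * Real.sqrt (c₁ * Fintype.card (Bond d m)) * Mφ' / Real.sqrt c₀) *
                  NegSup.wInvSup (levWeight (L : ℝ) η levB 0)) * δ * (C₂c * (εC + aC) ^ 2) + b' * δC) / (1 - 4 * b' * C₂c' * (ρC + sC)) := by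
  obtain ⟨α₀, δ₀, K, hα₀, hδ₀, hK, H⟩ :=
    exists_letter_defects_tower_pi_two_backgrounds_closed hd L hL φ hMφ hMφ' hφ hφ' ha₀ haP hr0 hr1 τ hτ hCτ hρw hτ₁ hτ₂ hφτ
  refine ⟨α₀, δ₀, K, hα₀, hδ₀, hK, ?_⟩
  intro n η _ hηL hL3 c₀ c₁ _ _ hw hρ m _ lev₀ levB lev₁ U V αU hα1 hU1 hreg αV hα1' hV1 hregV hα128 εU hεU hUε hVε δUV hδUV hLUV α δ hα0 hαle hδ0 hδle
    hUst hVst hUb hVb hUη hVη hplU hplV hUV hpp hεg hδg hposU' hposV' hposU hposV hQU hQV W₁ W₂ B₀ θ C₄ a₃ j a ε₄ B₀' θ' C₄' a₃' j' a' ε₄' δW ρ s R₁ R₂ hj hj' B hB hB'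
    hδW hρ₁ hρ₂ hs hdom hκ b C₂c c₄ aC εC b' C₂c' c₄' aC' εC' δC ρC sC RC₁ RC₂ hcap hcap' hδC hρC₁ hρC₂ hsC hdomC hκC
  obtain ⟨hι, HG, HA⟩ := H n η hηL hL3 c₀ c₁ hw hρ m lev₀ levB lev₁ U V αU hα1 hU1 hreg αV hα1' hV1 hregV hα128 εU hεU hUε hVε δUV hδUV hLUV hα0 hαle
    hδ0 hδle hUst hVst hUb hVb hUη hVη hplU hplV hUV hpp hεg hδg hposU' hposV' hposU hposV hQU hQV
  have hδη : 0 ≤ δ * η := mul_nonneg hδ0 (le_of_lt (Fact.out : 0 < η))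
  have hmax : 0 ≤ (max (NegSup.wSup (levWeight (L : ℝ) η lev₀ 1) : ℝ) (NegSup.wSup (levWeight (L : ℝ) η lev₁ 2) * (2 * ‖((η : ℂ))⁻¹‖))) :=
    le_max_of_le_left (NegSup.wSup (levWeight (L : ℝ) η lev₀ 1)).coe_nonneg
  have hKG : 0 ≤ K * (max (NegSup.wSup (levWeight (L : ℝ) η lev₀ 1) : ℝ) (NegSup.wSup (levWeight (L : ℝ) η lev₁ 2) * (2 * ‖((η : ℂ))⁻¹‖)) *
      (Mφ * Real.sqrt (c₀ * Fintype.card (Bond d (towerP L m (n + 1)))) * Mφ' / Real.sqrt c₀) * NegSup.wInvSup (levWeight (L : ℝ) η lev₀ 3)) * δ := by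
    positivity
  have hKA : 0 ≤ K * (max (NegSup.wSup (levWeight (L : ℝ) η lev₀ 1) : ℝ) (NegSup.wSup (levWeight (L : ℝ) η lev₁ 2) * (2 * ‖((η : ℂ))⁻¹‖)) *
      (Mφ * Real.sqrt (c₁ * Fintype.card (Bond d m)) * Mφ' / Real.sqrt c₀) * NegSup.wInvSup (levWeight (L : ℝ) η levB 0)) * δ := by
    positivity
  have hG' : ∀ f : NegSize (L : ℝ) η lev₀ 3 𝔸,
      ‖LinearMap.toContinuousLinearMap
          ((jetLinearEquiv (L : ℝ) η lev₀ lev₁ (nabla115 η V)).symm.toLinearMap ∘ₗ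
            (jetLinearEquiv (L : ℝ) η lev₀ lev₁ (nabla115 η U)).toLinearMap)
          (frakGLatticeCLM (L := (L : ℝ)) (η := η) (lev₀ := lev₀) φ hposU hQU lev₁ (nabla115 η U) f) -
        frakGLatticeCLM (L := (L : ℝ)) (η := η) (lev₀ := lev₀) φ hposV hQV lev₁ (nabla115 η V) f‖ ≤
      (K * (max (NegSup.wSup (levWeight (L : ℝ) η lev₀ 1) : ℝ) (NegSup.wSup (levWeight (L : ℝ) η lev₁ 2) * (2 * ‖((η : ℂ))⁻¹‖)) *
        (Mφ * Real.sqrt (c₀ * Fintype.card (Bond d (towerP L m (n + 1)))) * Mφ' / Real.sqrt c₀) * NegSup.wInvSup (levWeight (L : ℝ) η lev₀ 3)) * δ) * ‖f‖ :=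
    fun f => (HG f).trans_eq (by ring)
  have hA' : ∀ B : NegSize (L : ℝ) η levB 0 𝔸,
      ‖LinearMap.toContinuousLinearMap
          ((jetLinearEquiv (L : ℝ) η lev₀ lev₁ (nabla115 η V)).symm.toLinearMap ∘ₗ
            (jetLinearEquiv (L : ℝ) η lev₀ lev₁ (nabla115 η U)).toLinearMap)
          (H1LatticeCLM (L := (L : ℝ)) (η := η) (lev₀ := lev₀) (levB := levB) φ hposU hQU lev₁ (nabla115 η U) B) -
        H1LatticeCLM (L := (L : ℝ)) (η := η) (lev₀ := lev₀) (levB := levB) φ hposV hQV lev₁ (nabla115 η V) B‖ ≤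
      (K * (max (NegSup.wSup (levWeight (L : ℝ) η lev₀ 1) : ℝ) (NegSup.wSup (levWeight (L : ℝ) η lev₁ 2) * (2 * ‖((η : ℂ))⁻¹‖)) *
        (Mφ * Real.sqrt (c₁ * Fintype.card (Bond d m)) * Mφ' / Real.sqrt c₀) * NegSup.wInvSup (levWeight (L : ℝ) η levB 0)) * δ) * ‖B‖ :=
    fun B => (HA B).trans_eq (by ring)
  exact norm_map_chartHB_sectC_sub_le R₁ R₂ RC₁ RC₂ hj hj' hB hB' hcap hcap' (by positivity) hι hKG hG' hδW hKA hA' hδC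
    hρ₁ hρ₂ hs hdom hκ hρC₁ hρC₂ hsC hdomC hκC

end Literature.MathematicalPhysics.QuantumFieldTheory.Balaban1983to89.B11Eq174ChartContinuityTowerPiTwoBackgrounds

end
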